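import Mathlib.Analysis.Calculus.ImplicitContDiff
import Mathlib.Analysis.Calculus.Deriv.Pow
import Mathlib.Analysis.Calculus.Deriv.Mul
import Mathlib.Analysis.Calculus.ContDiff.RCLike
import Mathlib.Analysis.Complex.Basic
import HarnessLib

/-!
# A SIMPLE root of a monic cubic is a smooth function of the coefficients (Ahlfors, *Complex Analysis*, Ch. 8 §2; folklore — implicit function theorem)

Topic `Analysis/Calculus`; namespace `Literature.Analysis.Calculus`.  THEOREMS ONLY (no `def`, no instance, no notation, no axiom, no named fact, no `sorry`); Mathlib-only.
Cell `pub/hodgecm-mathlib`, crux H413 (`stmt-HodgeConjecture-24833`), line LH2 (closer stub `stub_N8`), N8-INNER road, brick (7) «(Σ-REG-G)» (owner LH3-p04 (g7)): the analytic engine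
of file F3 `…ClassMapSectionG` (the smooth local SECTION of the class map of the `G′`-charts at a regular point: at a compact place the three eigen-angles, at a split place
`(x, φ, θ)`, as smooth functions of the elementary symmetric functions `(σ₁, σ₂, σ₃)`) — the cubic twin of ★ `exists_contDiffOn_quadraticRoot_near` (`SimpleRootBranch`, the `H`-side
engine).  Author F0P3a-p04 (g27).  Count-neutral.

THE MATHEMATICS.  `P(σ, z) = z³ − σ₁z² + σ₂z − σ₃` is a polynomial map `(ℂ × ℂ × ℂ) × ℂ → ℂ`, hence `C^ω` over `ℂ`; at a SIMPLE root `z₀` of `P(σ⁰, ·)` (`∂_z P = 3z₀² − 2σ⁰₁z₀ + σ⁰₂ ≠ 0`)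
the partial derivative in `z` is an invertible `ℂ`-linear map `ℂ → ℂ`, so Mathlib's implicit function theorem (`ContDiffAt.implicitFunction`, `contDiffAt_implicitFunction`,
`eventually_apply_implicitFunction`) gives a `C^ω` germ `r` with `r σ⁰ = z₀` and `P(σ, r σ) = 0` near `σ⁰`; a `C^ω` germ is `C^ω` on a neighbourhood (`ContDiffAt.eventually`), and
real-`C^∞` follows by restriction of scalars.
* §1 `hasDerivAt_cubic` (the `z`-derivative), `isInvertible_of_apply_one_ne_zero_complex` (a non-zero `ℂ`-linear endomorphism of `ℂ` is invertible, via
  `ContinuousLinearEquiv.unitsEquivAut`; the `ℝ`-twin is ★ `ParametricCrossingTime.isInvertible_of_apply_one_ne_zero`), the partial derivative of `P` along `inr`.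
* §2 **`exists_contDiffOn_cubicRoot_near`**: `∃ U` open `∋ σ⁰`, `∃ r`, `ContDiffOn ℝ ∞ r U ∧ r σ⁰ = z₀ ∧ ∀ σ ∈ U, (r σ)³ − σ₁(r σ)² + σ₂(r σ) − σ₃ = 0` — same shape as ★
  `exists_contDiffOn_quadraticRoot_near`.
HONEST LABEL: calculus plumbing; HC_CM is proved only modulo the 7 printed citations (2 remaining: hLiu418 = stmt-HodgeConjecture-24832, h413 = stmt-HodgeConjecture-24833) until rung 0 closes.

## References
* [Ahlfors1979] L. V. Ahlfors, *Complex Analysis*, 3rd ed. (1979), Ch. 8 §2 (simple roots depend analytically on the coefficients).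
-/

set_option autoImplicit false

noncomputable section

open Set Topology Filter
open scoped ContDiff

namespace Literature.Analysis.Calculus

/-! ## §1 The cubic as an implicit equation -/

/-- **A non-zero `ℂ`-linear endomorphism of `ℂ` is invertible** (it is multiplication by its value at `1`, a unit; `ContinuousLinearEquiv.unitsEquivAut`). [cite: Ahlfors1979, Ch. 8 §2] -/
theorem isInvertible_of_apply_one_ne_zero_complex (T : ℂ →L[ℂ] ℂ) (hT : T 1 ≠ 0) : T.IsInvertible := by
  refine ⟨ContinuousLinearEquiv.unitsEquivAut ℂ (Units.mk0 (T 1) hT), ?_⟩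
  ext
  rw [ContinuousLinearEquiv.coe_coe, ContinuousLinearEquiv.unitsEquivAut_apply, Units.val_mk0, one_mul]

/-- The cubic `P(σ, z) = z³ − σ₁z² + σ₂z − σ₃` is `C^ω` on `(ℂ × ℂ × ℂ) × ℂ` (a polynomial map). [cite: Ahlfors1979, Ch. 8 §2] -/
theorem contDiff_cubicEquation :
    ContDiff ℂ ω fun p : (ℂ × ℂ × ℂ) × ℂ => p.2 ^ 3 - p.1.1 * p.2 ^ 2 + p.1.2.1 * p.2 - p.1.2.2 := by
  have h2 : ContDiff ℂ ω fun p : (ℂ × ℂ × ℂ) × ℂ => p.2 := contDiff_snd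
  have h11 : ContDiff ℂ ω fun p : (ℂ × ℂ × ℂ) × ℂ => p.1.1 := contDiff_fst.comp contDiff_fst
  have h121 : ContDiff ℂ ω fun p : (ℂ × ℂ × ℂ) × ℂ => p.1.2.1 := contDiff_fst.comp (contDiff_snd.comp contDiff_fst)
  have h122 : ContDiff ℂ ω fun p : (ℂ × ℂ × ℂ) × ℂ => p.1.2.2 := contDiff_snd.comp (contDiff_snd.comp contDiff_fst)
  exact (((h2.pow 3).sub (h11.mul (h2.pow 2))).add (h121.mul h2)).sub h122

/-- **The `z`-derivative of the cubic**: `d/dz (z³ − σ₁z² + σ₂z − σ₃) = 3z² − 2σ₁z + σ₂`. [cite: Ahlfors1979, Ch. 8 §2] -/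
theorem hasDerivAt_cubic (σ : ℂ × ℂ × ℂ) (z : ℂ) :
    HasDerivAt (fun z : ℂ => z ^ 3 - σ.1 * z ^ 2 + σ.2.1 * z - σ.2.2) (3 * z ^ 2 - 2 * σ.1 * z + σ.2.1) z := by
  have h3 := hasDerivAt_pow 3 z
  have h2 := (hasDerivAt_pow 2 z).const_mul σ.1
  have h1 := (hasDerivAt_id' z).const_mul σ.2.1
  have h := ((h3.sub h2).add h1).sub_const σ.2.2
  refine h.congr_deriv ?_
  push_cast
  ring

/-- **The partial derivative of `P` along the `z`-slot is multiplication by `3z² − 2σ₁z + σ₂`**: `(fderiv P (σ, z) ∘ inr) 1 = 3z² − 2σ₁z + σ₂` (chain rule through `w ↦ (σ, w)`,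
whose derivative is `inr`). [cite: Ahlfors1979, Ch. 8 §2] -/
theorem fderiv_cubicEquation_comp_inr_apply_one (σ : ℂ × ℂ × ℂ) (z : ℂ) :
    (fderiv ℂ (fun p : (ℂ × ℂ × ℂ) × ℂ => p.2 ^ 3 - p.1.1 * p.2 ^ 2 + p.1.2.1 * p.2 - p.1.2.2) (σ, z) ∘L ContinuousLinearMap.inr ℂ (ℂ × ℂ × ℂ) ℂ) 1 =
      3 * z ^ 2 - 2 * σ.1 * z + σ.2.1 := by
  -- the slice `w ↦ P (σ, w)` has derivative `fderiv P (σ, z) ∘ inr` (chain rule), and also `3z² − 2σ₁z + σ₂` (`hasDerivAt_cubic`)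
  have hP : DifferentiableAt ℂ (fun p : (ℂ × ℂ × ℂ) × ℂ => p.2 ^ 3 - p.1.1 * p.2 ^ 2 + p.1.2.1 * p.2 - p.1.2.2) (σ, z) :=
    contDiff_cubicEquation.contDiffAt.differentiableAt (by simp)
  have hslice : HasFDerivAt (fun w : ℂ => (σ, w)) (ContinuousLinearMap.inr ℂ (ℂ × ℂ × ℂ) ℂ) z := hasFDerivAt_prodMk_right σ z
  have hcomp : HasFDerivAt (fun w : ℂ => w ^ 3 - σ.1 * w ^ 2 + σ.2.1 * w - σ.2.2)
      (fderiv ℂ (fun p : (ℂ × ℂ × ℂ) × ℂ => p.2 ^ 3 - p.1.1 * p.2 ^ 2 + p.1.2.1 * p.2 - p.1.2.2) (σ, z) ∘L ContinuousLinearMap.inr ℂ (ℂ × ℂ × ℂ) ℂ) z :=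
    hP.hasFDerivAt.comp z hslice
  have hderiv : HasDerivAt (fun w : ℂ => w ^ 3 - σ.1 * w ^ 2 + σ.2.1 * w - σ.2.2)
      ((fderiv ℂ (fun p : (ℂ × ℂ × ℂ) × ℂ => p.2 ^ 3 - p.1.1 * p.2 ^ 2 + p.1.2.1 * p.2 - p.1.2.2) (σ, z) ∘L ContinuousLinearMap.inr ℂ (ℂ × ℂ × ℂ) ℂ) 1) z := by
    have h := hcomp.hasDerivAt
    simpa using h
  exact hderiv.unique (hasDerivAt_cubic σ z)

/-- **At a SIMPLE root the `z`-partial of `P` is invertible.** [cite: Ahlfors1979, Ch. 8 §2] -/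
theorem isInvertible_fderiv_cubicEquation_comp_inr {σ : ℂ × ℂ × ℂ} {z : ℂ} (hsimple : 3 * z ^ 2 - 2 * σ.1 * z + σ.2.1 ≠ 0) :
    (fderiv ℂ (fun p : (ℂ × ℂ × ℂ) × ℂ => p.2 ^ 3 - p.1.1 * p.2 ^ 2 + p.1.2.1 * p.2 - p.1.2.2) (σ, z) ∘L ContinuousLinearMap.inr ℂ (ℂ × ℂ × ℂ) ℂ).IsInvertible :=
  isInvertible_of_apply_one_ne_zero_complex _ (by rw [fderiv_cubicEquation_comp_inr_apply_one]; exact hsimple)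

/-! ## §2 The smooth simple-root branch -/

/-- **A SIMPLE ROOT OF A MONIC CUBIC IS A SMOOTH FUNCTION OF THE COEFFICIENTS.**  If `z₀³ − σ⁰₁z₀² + σ⁰₂z₀ − σ⁰₃ = 0` and `3z₀² − 2σ⁰₁z₀ + σ⁰₂ ≠ 0`, there are an open `U ∋ σ⁰` and
`r : ℂ × ℂ × ℂ → ℂ`, `C^∞` (real sense) on `U`, with `r σ⁰ = z₀` and `(r σ)³ − σ₁(r σ)² + σ₂(r σ) − σ₃ = 0` for all `σ ∈ U` (implicit function theorem over `ℂ`, class `C^ω`; Mathlib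
`ContDiffAt.implicitFunction`).  The cubic twin of ★ `exists_contDiffOn_quadraticRoot_near`. [cite: Ahlfors1979, Ch. 8 §2] -/
theorem exists_contDiffOn_cubicRoot_near {σ₀ : ℂ × ℂ × ℂ} {z₀ : ℂ} (hroot : z₀ ^ 3 - σ₀.1 * z₀ ^ 2 + σ₀.2.1 * z₀ - σ₀.2.2 = 0)
    (hsimple : 3 * z₀ ^ 2 - 2 * σ₀.1 * z₀ + σ₀.2.1 ≠ 0) :
    ∃ U : Set (ℂ × ℂ × ℂ), IsOpen U ∧ σ₀ ∈ U ∧ ∃ r : ℂ × ℂ × ℂ → ℂ, ContDiffOn ℝ ∞ r U ∧ r σ₀ = z₀ ∧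
      ∀ σ ∈ U, r σ ^ 3 - σ.1 * r σ ^ 2 + σ.2.1 * r σ - σ.2.2 = 0 := by
  -- the implicit function of `P` at `(σ₀, z₀)`, class `C^ω` over `ℂ`
  have cdf : ContDiffAt ℂ ω (fun p : (ℂ × ℂ × ℂ) × ℂ => p.2 ^ 3 - p.1.1 * p.2 ^ 2 + p.1.2.1 * p.2 - p.1.2.2) (σ₀, z₀) := contDiff_cubicEquation.contDiffAt
  have pn : (ω : WithTop ℕ∞) ≠ 0 := by simp
  have if₂ := isInvertible_fderiv_cubicEquation_comp_inr (σ := σ₀) (z := z₀) hsimple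
  set r := cdf.implicitFunction pn if₂ with hr
  have hr0 : r σ₀ = z₀ := cdf.implicitFunction_apply_self pn if₂
  have hreq : ∀ᶠ σ in 𝓝 σ₀, r σ ^ 3 - σ.1 * r σ ^ 2 + σ.2.1 * r σ - σ.2.2 = 0 := by
    filter_upwards [cdf.eventually_apply_implicitFunction pn if₂] with σ hσ
    have h' : r σ ^ 3 - σ.1 * r σ ^ 2 + σ.2.1 * r σ - σ.2.2 = z₀ ^ 3 - σ₀.1 * z₀ ^ 2 + σ₀.2.1 * z₀ - σ₀.2.2 := hσ
    rw [h', hroot]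
  have hsmooth : ∀ᶠ σ in 𝓝 σ₀, ContDiffAt ℂ ω r σ := (cdf.contDiffAt_implicitFunction pn if₂).eventually (by simp)
  -- an open neighbourhood on which both hold
  obtain ⟨U, hU, hUo, hσ₀U⟩ := mem_nhds_iff.1 (Filter.inter_mem hreq hsmooth)
  refine ⟨U, hUo, hσ₀U, r, fun σ hσ => ?_, hr0, fun σ hσ => (hU hσ).1⟩
  have hω : ContDiffAt ℂ ω r σ := (hU hσ).2
  exact ((hω.of_le le_top).restrict_scalars ℝ).contDiffWithinAt

end Literature.Analysis.Calculus

end
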